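import Summits.AtomisticToContinuum.Crystallization.Theorems.ChargedEnergyGapAffineChart
import HarnessLib

/-!
(SPLIT FOR THE 400-LINE CAP by the landing lane, hand-2 g33: this file = part 1 of 3; sequels `…ChargedEnergyGapAffineChargingB`, `…ChargedEnergyGapAffineCharging` import it in a chain; same namespace, all FQNs unchanged.)
# Charged energy gap — lens-3 g66, node «AffineChart» (part 29b): the affine sub-family of (H𝄪ᴮ) at the record dials by sitewise
completion of the square

Line of record `stmt-AtomisticToContinuum-14231`.  Part 29a (`ChargedEnergyGapAffineChart`) set up the affine instances `affineField A`, the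
affine sub-family `AffineFamilyB ⊂ (H𝄪ᴮ)`, the reference-class input `SitewiseAffineStabilityB` and the cocycle chart.  Here:

* §E the strain hypothesis of an affine instance bounds the linear map: `‖A x‖ ≤ τ‖x‖` (lattice directions at all scales + density of `ℚΛ`);
* §F affine bond/site forms: `|bondLin| ≤ a(d⁻¹² + d⁻⁶)`, `|bondQuad| ≤ 14a²(…)`, summability, and ★ the UNEXCISED LINEAR SITE TERM VANISHES at
  a site-stress-free site (`linSite_affineField_empty_eq_zero`: it is the site virial paired with `A`);
* §G excision splits `lin^X = lin^∅ − (excised)`, the core kernel `d⁻¹² + d⁻⁶`, the far bounds in the softening regime `d ≥ 2`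
  (`bondLin ≤ b·(V′)⁺d` with `b` the numerical radius of `A`, `bondQuad ≤ a²·(V′)⁺d`), and ★★ the SITEWISE COMPLETION OF THE SQUARE
  `affine_site_bound`: `lin + λ·quad ≥ −(F/(16λκ) + λa²/4)·E_far − (a/2 + 7λa²/2)·K_near` from `κb² ≤ q^∅(A)` and `E_far ≤ F`;
* §H the near-core debits refolded onto the priced excised sites (`coreMassL_near_le`: `≤ (1024/(s³s⁹) + 1024/(s³s³))·pricedNearCountL`);
* §I ★★★ P-Xᵃ `modelFarL_affine_ge`: the geometric charging form of the affine instances with the SHARP far tail;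
* §J ★★★ the glue `affineFamilyB_of_bulkB` and the record corollary `affineFamilyB_record_of_stability_of_bulkBoundB`:
  `SitewiseAffineStabilityB (3/5) (1/3) 3 (1/100) (1/5)` + `BulkFarResidueBoundB (3/5) (1/3) 3 (1/100) 160 80 (1/2100) (1/46) B_H` ⟹
  `AffineFamilyB (3/5) (1/3) 3 (1/100) (3/100) (1/2) 160 (2/5) 3 (1/3000000) 80 (1/100000)` (`κ_t = 1/3800`, `h = 12/5`; the budget closes
  for every `κ ≥ 1/10` and fails at `κ = 1/12`, `record_affine_numerals`).

0 sorry; standard axioms.  Checked as the monolith `g66/check/AffineCharging_mono.lean` (part 29a is not yet in the tree).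
-/

noncomputable section

open scoped Classical
open Literature.MathematicalPhysics.StatisticalMechanics Literature.Geometry.DiscreteGeometry
open Summit.AtomisticToContinuum.Crystallization.Theses.PricedLinkCensus
open Summit.AtomisticToContinuum.Crystallization.Theorems.ChargedEnergyGapNegative

namespace Summit.AtomisticToContinuum.Crystallization.Theorems.ChargedEnergyGapChartDial

/-! ## §E  The strain bound of an affine instance -/
section AffineStrain

variable {τ : ℝ} {P : PeriodicConfiguration 3} {X : Set E3} {A : E3 →ₗ[ℝ] E3}

/-- `SmallStrain τ` at one non-excised site bounds the affine field on the LATTICE: `‖A g‖ ≤ τ‖g‖`. -/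
theorem smallStrain_affine_lattice (hW : SmallStrain τ P X (affineField A)) (hX : IsInvariantSet P X) {y : E3} (hy : y ∈ P.points)
    (hyX : y ∉ X) {g : E3} (hg : g ∈ P.lattice) : ‖A g‖ ≤ τ * ‖g‖ := by
  have hyg : y + g ∈ P.points := P.add_mem_points hy hg
  have hygX : y + g ∉ X := fun h => hyX ((hX g hg y).1 h)
  have h := hW y hy (y + g) hyg hyX hygX
  rwa [affineField_add_right, dist_eq_norm, sub_add_cancel_left, norm_neg] at h

/-- ★★ **THE AFFINE STRAIN BOUND ON ALL OF `ℝ³`**: if some site is non-excised, `‖A x‖ ≤ τ‖x‖` for EVERY `x` (lattice vectors `gₙ`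
approximate `n·x` within `M`, `n‖A x‖ ≤ τ(n‖x‖ + M) + ‖A‖·M`, divide by `n → ∞`; §X2 for rotations). -/
theorem smallStrain_affine_bound (hτ : 0 ≤ τ) (hW : SmallStrain τ P X (affineField A)) (hX : IsInvariantSet P X) {y : E3}
    (hy : y ∈ P.points) (hyX : y ∉ X) (x : E3) : ‖A x‖ ≤ τ * ‖x‖ := by
  obtain ⟨M, hM0, hM⟩ := exists_lattice_near P
  set L : E3 →L[ℝ] E3 := LinearMap.toContinuousLinearMap A with hL
  have hLA : ∀ w, L w = A w := fun w => rfl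
  set K : ℝ := τ * M + ‖L‖ * M with hK
  have hK0 : 0 ≤ K := by positivity
  have key : ∀ n : ℕ, (n : ℝ) * ‖A x‖ ≤ τ * ((n : ℝ) * ‖x‖) + K := by
    intro n
    obtain ⟨g, hg, hgx⟩ := hM ((n : ℝ) • x)
    have hWg := smallStrain_affine_lattice hW hX hy hyX hg
    have hsplit : A ((n : ℝ) • x) = A g + A ((n : ℝ) • x - g) := by rw [← map_add, add_sub_cancel]
    have herr : ‖A ((n : ℝ) • x - g)‖ ≤ ‖L‖ * M := by
      rw [← hLA]
      exact (L.le_opNorm _).trans (mul_le_mul_of_nonneg_left hgx (norm_nonneg _))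
    have hgn : ‖g‖ ≤ (n : ℝ) * ‖x‖ + M := by
      have h1 : ‖g‖ ≤ ‖(n : ℝ) • x‖ + ‖(n : ℝ) • x - g‖ := by
        have h := norm_sub_le ((n : ℝ) • x) ((n : ℝ) • x - g)
        rwa [sub_sub_cancel] at h
      rw [norm_smul, Real.norm_eq_abs, abs_of_nonneg (Nat.cast_nonneg n)] at h1
      linarith
    calc (n : ℝ) * ‖A x‖ = ‖A ((n : ℝ) • x)‖ := by
          rw [map_smul, norm_smul, Real.norm_eq_abs, abs_of_nonneg (Nat.cast_nonneg n)]
      _ ≤ ‖A g‖ + ‖A ((n : ℝ) • x - g)‖ := by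
          rw [hsplit]
          exact norm_add_le _ _
      _ ≤ τ * ‖g‖ + ‖L‖ * M := add_le_add hWg herr
      _ ≤ τ * ((n : ℝ) * ‖x‖ + M) + ‖L‖ * M := by gcongr
      _ = τ * ((n : ℝ) * ‖x‖) + K := by
          rw [hK]
          ring
  refine le_of_forall_pos_lt_add fun ε hε => ?_
  obtain ⟨n, hn⟩ := exists_nat_gt (K / ε)
  have hn0 : (0 : ℝ) < n := lt_of_le_of_lt (div_nonneg hK0 hε.le) hn
  have hKn : K < (n : ℝ) * ε := (div_lt_iff₀ hε).1 hn
  have h := key n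
  by_contra hc
  push Not at hc
  have h2 := mul_le_mul_of_nonneg_left hc hn0.le
  linarith

end AffineStrain

/-! ## §F  Affine bond and site forms; the unexcised linear site term vanishes at a site-stress-free site -/
section AffineSite

variable (P : PeriodicConfiguration 3) (A : E3 →ₗ[ℝ] E3) (y : E3)

/-- The linear bond term of an affine field: `(V′(d)/d)·⟪x, A x⟫`, `x = z − y`. -/
theorem bondLin_affineField (z : E3) :
    bondLin (affineField A) y z = ljD1 (dist y z) / dist y z * inner ℝ (z - y) (A (z - y)) := by
  unfold bondLin
  rw [affineField_apply, real_inner_smul_left, div_eq_mul_inv]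
  ring

/-- `⟪x, A x⟫ = Σᵢ ⟪x, eᵢ⟫·⟪x, A eᵢ⟫` in the standard orthonormal frame. -/
theorem inner_apply_eq_sum (x : E3) :
    inner ℝ x (A x) = ∑ i, inner ℝ x (EuclideanSpace.basisFun (Fin 3) ℝ i) * inner ℝ x (A (EuclideanSpace.basisFun (Fin 3) ℝ i)) := by
  set b := EuclideanSpace.basisFun (Fin 3) ℝ
  calc inner ℝ x (A x) = inner ℝ x (A (∑ i, inner ℝ (b i) x • b i)) := by rw [b.sum_repr' x]
    _ = ∑ i, inner ℝ (b i) x * inner ℝ x (A (b i)) := by simp only [map_sum, map_smul, inner_sum, real_inner_smul_right]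
    _ = _ := Finset.sum_congr rfl fun i _ => by rw [real_inner_comm (b i)]

/-- Reindexing: with NO excised set the linear site term is a sum over all points `z ≠ y`. -/
theorem linSite_empty_eq (β : E3 → E3 → E3) :
    linSite β P ∅ y = (1 / 2) * ∑' z : {z : E3 // z ∈ P.points ∧ z ≠ y}, bondLin β y (z : E3) := by
  unfold linSite
  congr 1
  let e : {z : E3 // z ∈ P.points ∧ z ∉ (∅ : Set E3) ∧ z ≠ y} ≃ {z : E3 // z ∈ P.points ∧ z ≠ y} :=
    Equiv.subtypeEquivRight fun z => by simp
  rw [← e.symm.tsum_eq]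
  rfl

variable {P y}

/-- ★ **At a SITE-STRESS-FREE motif site the UNEXCISED linear site term of every affine field vanishes**:
`Σ'_z (V′/d)⟪x, A x⟫ = Σᵢ T_y(eᵢ, A eᵢ) = 0`. -/
theorem linSite_affineField_empty_eq_zero (hS : IsSiteStressFree P) (hy : y ∈ P.motif) : linSite (affineField A) P ∅ y = 0 := by
  rw [linSite_empty_eq]
  set b := EuclideanSpace.basisFun (Fin 3) ℝ
  have h : ∀ z : {z : E3 // z ∈ P.points ∧ z ≠ y}, bondLin (affineField A) y (z : E3) =
      ∑ i, ljD1 (dist y z) / dist y (z : E3) * (inner ℝ ((z : E3) - y) (b i) * inner ℝ ((z : E3) - y) (A (b i))) := fun z => by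
    rw [bondLin_affineField, inner_apply_eq_sum, Finset.mul_sum]
  rw [tsum_congr h, Summable.tsum_finsetSum (fun i _ => summable_virial P y (b i) (A (b i)))]
  have h0 : ∀ i, ∑' z : {z : E3 // z ∈ P.points ∧ z ≠ y}, ljD1 (dist y z) / dist y (z : E3) *
      (inner ℝ ((z : E3) - y) (b i) * inner ℝ ((z : E3) - y) (A (b i))) = 0 := fun i => hS y hy (b i) (A (b i))
  simp only [h0, Finset.sum_const_zero, mul_zero]

variable (P y)

/-- `|V″(t)| ≤ 13t⁻¹⁴ + 7t⁻⁸` for `t > 0`. -/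
theorem abs_ljD2_le {t : ℝ} (ht : 0 < t) : |ljD2 t| ≤ 13 * (t⁻¹) ^ 14 + 7 * (t⁻¹) ^ 8 := by
  unfold ljD2
  refine (abs_sub _ _).trans ?_
  rw [abs_of_nonneg (by positivity), abs_of_nonneg (by positivity)]

/-- The linear bond term of an affine field with `‖A x‖ ≤ a‖x‖` is dominated by `a·(d⁻¹² + d⁻⁶)`. -/
theorem abs_bondLin_affineField_le {a : ℝ} (ha : ∀ x, ‖A x‖ ≤ a * ‖x‖) (z : {z : E3 // z ∈ P.points ∧ z ≠ y}) :
    |bondLin (affineField A) y z| ≤ a * ((dist y (z : E3))⁻¹ ^ 12 + (dist y (z : E3))⁻¹ ^ 6) := by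
  have hd : 0 < dist y (z : E3) := dist_pos.2 fun h => z.2.2 h.symm
  have ha0 : 0 ≤ a := by
    have h := ha ((z : E3) - y)
    have hn : 0 < ‖(z : E3) - y‖ := by rw [← norm_sub_rev, ← dist_eq_norm]; exact hd
    nlinarith [norm_nonneg (A ((z : E3) - y))]
  unfold bondLin
  rw [affineField_apply]
  set d := dist y (z : E3) with hd_def
  have hx : ‖(z : E3) - y‖ = d := by rw [hd_def, dist_eq_norm, norm_sub_rev]
  have hin : |inner ℝ (d⁻¹ • ((z : E3) - y)) (A ((z : E3) - y))| ≤ a * d := by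
    calc |inner ℝ (d⁻¹ • ((z : E3) - y)) (A ((z : E3) - y))| ≤ ‖d⁻¹ • ((z : E3) - y)‖ * ‖A ((z : E3) - y)‖ :=
          abs_real_inner_le_norm _ _
      _ = ‖A ((z : E3) - y)‖ := by rw [norm_smul, Real.norm_eq_abs, abs_of_pos (inv_pos.2 hd), hx, inv_mul_cancel₀ hd.ne', one_mul]
      _ ≤ a * ‖(z : E3) - y‖ := ha _
      _ = a * d := by rw [hx]
  rw [abs_mul]
  calc |ljD1 d| * |inner ℝ (d⁻¹ • ((z : E3) - y)) (A ((z : E3) - y))| ≤ (d⁻¹ ^ 13 + d⁻¹ ^ 7) * (a * d) :=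
        mul_le_mul (abs_ljD1_le d hd) hin (abs_nonneg _) (by positivity)
    _ = a * (d⁻¹ ^ 12 + d⁻¹ ^ 6) * (d⁻¹ * d) := by ring
    _ = a * (d⁻¹ ^ 12 + d⁻¹ ^ 6) := by rw [inv_mul_cancel₀ hd.ne', mul_one]

/-- The quadratic bond term of an affine field with `‖A x‖ ≤ a‖x‖` is dominated by `14a²·(d⁻¹² + d⁻⁶)`. -/
theorem abs_bondQuad_affineField_le {a : ℝ} (ha : ∀ x, ‖A x‖ ≤ a * ‖x‖) (z : {z : E3 // z ∈ P.points ∧ z ≠ y}) :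
    |bondQuad (affineField A) y z| ≤ 14 * a ^ 2 * ((dist y (z : E3))⁻¹ ^ 12 + (dist y (z : E3))⁻¹ ^ 6) := by
  have hd : 0 < dist y (z : E3) := dist_pos.2 fun h => z.2.2 h.symm
  unfold bondQuad
  rw [affineField_apply]
  set d := dist y (z : E3) with hd_def
  have hx : ‖(z : E3) - y‖ = d := by rw [hd_def, dist_eq_norm, norm_sub_rev]
  set q := inner ℝ (d⁻¹ • ((z : E3) - y)) (A ((z : E3) - y)) with hq
  set w := ‖A ((z : E3) - y)‖ with hw
  have hw0 : 0 ≤ w := norm_nonneg _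
  have hwa : w ≤ a * d := by rw [hw, ← hx]; exact ha _
  have hqw : |q| ≤ w := by
    calc |q| ≤ ‖d⁻¹ • ((z : E3) - y)‖ * ‖A ((z : E3) - y)‖ := abs_real_inner_le_norm _ _
      _ = w := by rw [norm_smul, Real.norm_eq_abs, abs_of_pos (inv_pos.2 hd), hx, inv_mul_cancel₀ hd.ne', one_mul]
  have hq2 : q ^ 2 ≤ w ^ 2 := by
    rw [← sq_abs q]
    exact pow_le_pow_left₀ (abs_nonneg q) hqw 2
  have hw2 : w ^ 2 ≤ (a * d) ^ 2 := pow_le_pow_left₀ hw0 hwa 2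
  have h1 : |ljD2 d * q ^ 2| ≤ (13 * d⁻¹ ^ 14 + 7 * d⁻¹ ^ 8) * (a * d) ^ 2 := by
    rw [abs_mul, abs_of_nonneg (sq_nonneg q)]
    exact mul_le_mul (abs_ljD2_le hd) (hq2.trans hw2) (sq_nonneg q) (by positivity)
  have h2 : |ljD1 d / d * (w ^ 2 - q ^ 2)| ≤ (d⁻¹ ^ 13 + d⁻¹ ^ 7) / d * (a * d) ^ 2 := by
    rw [abs_mul, abs_div, abs_of_pos hd, abs_of_nonneg (by linarith : 0 ≤ w ^ 2 - q ^ 2)]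
    exact mul_le_mul (div_le_div_of_nonneg_right (abs_ljD1_le d hd) hd.le) (by nlinarith [sq_nonneg q]) (by linarith) (by positivity)
  have hdi : d⁻¹ * d = 1 := inv_mul_cancel₀ hd.ne'
  calc |ljD2 d * q ^ 2 + ljD1 d / d * (w ^ 2 - q ^ 2)| ≤ |ljD2 d * q ^ 2| + |ljD1 d / d * (w ^ 2 - q ^ 2)| := abs_add_le _ _
    _ ≤ (13 * d⁻¹ ^ 14 + 7 * d⁻¹ ^ 8) * (a * d) ^ 2 + (d⁻¹ ^ 13 + d⁻¹ ^ 7) / d * (a * d) ^ 2 := add_le_add h1 h2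
    _ = a ^ 2 * (14 * d⁻¹ ^ 12 + 8 * d⁻¹ ^ 6) * (d⁻¹ * d) ^ 2 := by
        rw [div_eq_mul_inv]
        ring
    _ = a ^ 2 * (14 * d⁻¹ ^ 12 + 8 * d⁻¹ ^ 6) := by rw [hdi, one_pow, mul_one]
    _ ≤ 14 * a ^ 2 * (d⁻¹ ^ 12 + d⁻¹ ^ 6) := by nlinarith [sq_nonneg a, pow_pos (inv_pos.2 hd) 6, pow_pos (inv_pos.2 hd) 12]

/-- Hence both affine bond terms are summable over the points. -/
theorem summable_bondLin_affineField {a : ℝ} (ha : ∀ x, ‖A x‖ ≤ a * ‖x‖) :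
    Summable fun z : {z : E3 // z ∈ P.points ∧ z ≠ y} => bondLin (affineField A) y (z : E3) := by
  have h12 := P.summable_inv_pow_dist (show 3 < 12 by norm_num) y
  have h6 := P.summable_inv_pow_dist (show 3 < 6 by norm_num) y
  refine Summable.of_norm_bounded (((h12.add h6).mul_left a)) fun z => ?_
  rw [Real.norm_eq_abs]
  exact abs_bondLin_affineField_le P A y ha z

/-- `summable_bondQuad_affineField`. [formal bookkeeping] -/
theorem summable_bondQuad_affineField {a : ℝ} (ha : ∀ x, ‖A x‖ ≤ a * ‖x‖) :
    Summable fun z : {z : E3 // z ∈ P.points ∧ z ≠ y} => bondQuad (affineField A) y (z : E3) := by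
  have h12 := P.summable_inv_pow_dist (show 3 < 12 by norm_num) y
  have h6 := P.summable_inv_pow_dist (show 3 < 6 by norm_num) y
  refine Summable.of_norm_bounded (((h12.add h6).mul_left (14 * a ^ 2))) fun z => ?_
  rw [Real.norm_eq_abs]
  exact abs_bondQuad_affineField_le P A y ha z

end AffineSite

/-! ## §G  Excision splits, the core kernel, and the sitewise completion of the square -/
section CoreKernel

/-- The CORE KERNEL `t⁻¹² + t⁻⁶` dominating every LJ bond coefficient (`|V′|t`, `|V″|t²` up to constants). -/
def coreKernel (t : ℝ) : ℝ := (t⁻¹) ^ 12 + (t⁻¹) ^ 6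

/-- `coreKernel_nonneg` (docstring added by the landing lane; see the module docstring). [formal bookkeeping] -/
theorem coreKernel_nonneg {t : ℝ} (ht : 0 < t) : 0 ≤ coreKernel t := by
  unfold coreKernel; positivity

variable (P : PeriodicConfiguration 3) (Y : Set E3) (y : E3)

/-- The **CORE SUM INTO `Y`** at `y`: `Σ'_{z ∈ P ∩ Y, z ≠ y} (d⁻¹² + d⁻⁶)` (the currency of the near-core debits). -/
def coreSum : ℝ :=
  ∑' z : {z : E3 // z ∈ P.points ∧ z ≠ y}, if (z : E3) ∈ Y then coreKernel (dist y z) else 0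

/-- `coreSummand_nonneg` (docstring added by the landing lane; see the module docstring). [formal bookkeeping] -/
theorem coreSummand_nonneg (z : {z : E3 // z ∈ P.points ∧ z ≠ y}) : 0 ≤ (if (z : E3) ∈ Y then coreKernel (dist y z) else 0) := by
  split_ifs
  · exact coreKernel_nonneg (dist_pos.2 fun h => z.2.2 h.symm)
  · exact le_rfl

/-- `coreSummand_le` (docstring added by the landing lane; see the module docstring). [formal bookkeeping] -/
theorem coreSummand_le (z : {z : E3 // z ∈ P.points ∧ z ≠ y}) :
    (if (z : E3) ∈ Y then coreKernel (dist y z) else 0) ≤ coreKernel (dist y z) := by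
  split_ifs
  · exact le_rfl
  · exact coreKernel_nonneg (dist_pos.2 fun h => z.2.2 h.symm)

/-- The core kernel is summable over the points (`P.summable_inv_pow_dist` at the powers 12 and 6). -/
theorem summable_coreKernel : Summable fun z : {z : E3 // z ∈ P.points ∧ z ≠ y} => coreKernel (dist y z) :=
  (P.summable_inv_pow_dist (show 3 < 12 by norm_num) y).add (P.summable_inv_pow_dist (show 3 < 6 by norm_num) y)

/-- `summable_coreSummand` (docstring added by the landing lane; see the module docstring). [formal bookkeeping] -/
theorem summable_coreSummand : Summable fun z : {z : E3 // z ∈ P.points ∧ z ≠ y} => if (z : E3) ∈ Y then coreKernel (dist y z) else 0 :=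
  Summable.of_nonneg_of_le (coreSummand_nonneg P Y y) (coreSummand_le P Y y) (summable_coreKernel P y)

/-- `coreSum_nonneg` (docstring added by the landing lane; see the module docstring). [formal bookkeeping] -/
theorem coreSum_nonneg : 0 ≤ coreSum P Y y := tsum_nonneg (coreSummand_nonneg P Y y)

/-- `coreSum P Y y ≤ Σ'_z (d⁻¹² + d⁻⁶)` (the universal core sum). -/
theorem coreSum_le_univ : coreSum P Y y ≤ ∑' z : {z : E3 // z ∈ P.points ∧ z ≠ y}, coreKernel (dist y z) :=
  Summable.tsum_le_tsum (coreSummand_le P Y y) (summable_coreSummand P Y y) (summable_coreKernel P y)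

end CoreKernel

section ExcisionSplit

variable (β : E3 → E3 → E3) (P : PeriodicConfiguration 3) (X : Set E3) (y : E3)

/-- The linear site term as ONE `tsum` over all points with the indicator of `P ∖ X` (P-S `quadSite_eq_tsum_ite` for the linear term). -/
theorem linSite_eq_tsum_ite :
    linSite β P X y = (1 / 2) * ∑' z : {z : E3 // z ∈ P.points ∧ z ≠ y}, if (z : E3) ∉ X then bondLin β y (z : E3) else 0 := by
  unfold linSite
  congr 1
  let T := {z : E3 // z ∈ P.points ∧ z ≠ y}
  let s : Set T := {z | (z : E3) ∉ X}
  let e : {z : E3 // z ∈ P.points ∧ z ∉ X ∧ z ≠ y} ≃ s :=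
    { toFun := fun z => ⟨⟨z.1, z.2.1, z.2.2.2⟩, z.2.2.1⟩
      invFun := fun z => ⟨z.1.1, z.1.2.1, z.2, z.1.2.2⟩
      left_inv := fun z => rfl
      right_inv := fun z => rfl }
  have h2 : ∑' z : {z : E3 // z ∈ P.points ∧ z ∉ X ∧ z ≠ y}, bondLin β y (z : E3) = ∑' z : s, bondLin β y ((z : T) : E3) := by
    rw [← e.tsum_eq]; rfl
  rw [h2, tsum_subtype s fun z : T => bondLin β y (z : E3)]
  refine tsum_congr fun z => ?_
  simp only [Set.indicator_apply, s, Set.mem_setOf_eq]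

/-- Splitting a summable `tsum` by an indicator: `Σ' 𝟙_{¬p}·f = Σ' f − Σ' 𝟙_p·f`. [formal bookkeeping] -/
theorem tsum_ite_not_eq_sub {T : Type*} (f : T → ℝ) (p : T → Prop) (hf : Summable f) :
    ∑' z, (if ¬ p z then f z else 0) = ∑' z, f z - ∑' z, (if p z then f z else 0) := by
  have hs : Summable fun z => if p z then f z else 0 :=
    (hf.indicator {z | p z}).congr fun z => by simp only [Set.indicator_apply, Set.mem_setOf_eq]
  rw [← hf.tsum_sub hs]
  refine tsum_congr fun z => ?_
  split_ifs <;> simp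

/-- `Summable` of an indicator-restricted summable family. [formal bookkeeping] -/
theorem summable_ite_of_summable {T : Type*} (f : T → ℝ) (p : T → Prop) (hf : Summable f) :
    Summable fun z => if p z then f z else 0 :=
  (hf.indicator {z | p z}).congr fun z => by simp only [Set.indicator_apply, Set.mem_setOf_eq]

/-- ★ **EXCISION SPLIT OF THE LINEAR SITE TERM**: `l^X_y(β) = l^∅_y(β) − ½ Σ'_{z ∈ X} bondLin` for a summable bond family. -/
theorem linSite_eq_empty_sub (hf : Summable fun z : {z : E3 // z ∈ P.points ∧ z ≠ y} => bondLin β y (z : E3)) :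
    linSite β P X y = linSite β P ∅ y -
      (1 / 2) * ∑' z : {z : E3 // z ∈ P.points ∧ z ≠ y}, if (z : E3) ∈ X then bondLin β y (z : E3) else 0 := by
  rw [linSite_eq_tsum_ite, linSite_empty_eq, tsum_ite_not_eq_sub _ (fun z : {z : E3 // z ∈ P.points ∧ z ≠ y} => (z : E3) ∈ X) hf]
  ring

/-- ★ **EXCISION SPLIT OF THE QUADRATIC SITE TERM**: `q^X_y(β) = q^∅_y(β) − ¼ Σ'_{z ∈ X} bondQuad`. -/
theorem quadSite_eq_empty_sub (hf : Summable fun z : {z : E3 // z ∈ P.points ∧ z ≠ y} => bondQuad β y (z : E3)) :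
    quadSite β P X y = quadSite β P ∅ y -
      (1 / 4) * ∑' z : {z : E3 // z ∈ P.points ∧ z ≠ y}, if (z : E3) ∈ X then bondQuad β y (z : E3) else 0 := by
  rw [quadSite_eq_tsum_ite, quadSite_empty_eq, tsum_ite_not_eq_sub _ (fun z : {z : E3 // z ∈ P.points ∧ z ≠ y} => (z : E3) ∈ X) hf]
  ring

end ExcisionSplit

end Summit.AtomisticToContinuum.Crystallization.Theorems.ChargedEnergyGapChartDial

end
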